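import Literature.NumberTheory.LFunctions.PowerOscillatoryIntegrals
import HarnessLib

/-!
# The Mellin transform of `sin`: `∫_0^∞ sin(u) u^{z-1} du = Γ(z) sin(πz/2)` on `-1 < Re z < 0`

Topic `Literature/Analysis/SpecialFunctions`. Euler's integral
`∫_0^∞ u^{z-1} sin u du = Γ(z) sin(πz/2)`, valid (conditionally) for `-1 < Re z < 1`, is an
absolutely convergent — hence Bochner/`mellin` — identity exactly on the strip `-1 < Re z < 0`
(`|sin u| u^{Re z - 1}` is integrable at `0` iff `Re z > -1` and at `∞` iff `Re z < 0`). We prove it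
there (`Literature.Analysis.SpecialFunctions.mellin_sin`, `hasMellin_sin`), and deduce the Mellin transform of the "sinc" kernel
`sincKernel t = 2 sinc(2πt) = sin(2πt)/(πt)` (Mathlib's `Real.sinc`, so the value at `t = 0` is the
limit `2`) on `0 < Re s < 1`:
`∫_0^∞ (sin 2πt/(πt)) t^{s-1} dt = -2(2π)^{-s} cos(πs/2) Γ(s-1)`
(`Literature.Analysis.SpecialFunctions.hasMellin_sincKernel`), which by Riemann's functional equation
`ζ(1-s) = 2(2π)^{-s} Γ(s) cos(πs/2) ζ(s)` (Mathlib `riemannZeta_one_sub`) is `ζ(1-s)/((1-s)ζ(s))`: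
this is Báez-Duarte's `U χ = sin(2πt)/(πt)` for his invariant unitary operator `U`, the form in
which it enters the Báez-Duarte–Balazard–Landreau–Saias lower bound
(`Literature.Barriers.RiemannHypothesis.BDBLS2000_uniform`, whose proof is the intended user of this file).

The two general lemmas used from `Literature/NumberTheory/LFunctions/PowerOscillatoryIntegrals.lean`
(`∫_0^∞ u^{a-1}e^{-ru}du = r^{-a}Γ(a)` for complex `r`, and an integrability lemma) are pure
analysis; the import direction is a convenience, not a dependence on number theory.

## The argument

Damp by `e^{-εu}`: for `ε > 0` integrate by parts on `(0,∞)` (Mathlib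
`integral_Ioi_mul_deriv_eq_deriv_mul`, `u^{z-1} = (u^z/z)'`, boundary terms vanish since
`-1 < Re z < 0`) to get `∫ e^{-εu} sin u · u^{z-1} = -(1/z) ∫ e^{-εu}(cos u - ε sin u) u^z`, evaluate
with `∫_0^∞ u^{(z+1)-1} e^{-ru} du = r^{-(z+1)} Γ(z+1)`, `r = ε ∓ i`
(`Literature.NumberTheory.LFunctions.AFE.integral_cpow_mul_exp_neg_mul_Ioi_complex`), and let `ε → 0+`: dominated convergence on
the left, continuity of `r ↦ (1/r)^{z+1}` at `r = ∓ i` on the right; finally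
`i^{z+1} + (-i)^{z+1} = 2cos(π(z+1)/2) = -2 sin(πz/2)` and `Γ(z+1) = zΓ(z)`.

## References

* Classical (Euler); e.g. E. C. Titchmarsh, *The Theory of the Riemann Zeta-Function*, 2nd ed.,
  §2.1 (the evaluation used in the first proof of the functional equation); I. S. Gradshteyn,
  I. M. Ryzhik, *Table of Integrals, Series, and Products*, 3.761 (4).
* L. Báez-Duarte, *A class of invariant unitary operators*, Adv. Math. 144 (1999), 1–12
  (`Uχ = sin(2πt)/(πt)`), as quoted in J.-F. Burnol, Adv. Math. 170 (2002), proof of Thm. 5.3.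
-/

noncomputable section

open Complex MeasureTheory Set Filter
open scoped Real Topology

namespace Literature.Analysis.SpecialFunctions

namespace MellinSin

variable {z : ℂ}

/-- The damped integrand `e^{-εu} sin u · u^{z-1}` (complex-valued; `ε = 0` is the undamped one).
[folklore] -/
def dampedIntegrand (z : ℂ) (ε u : ℝ) : ℂ :=
  ((Real.exp (-(ε * u)) * Real.sin u : ℝ) : ℂ) * (u : ℂ) ^ (z - 1)

/-- The dominating function `𝟙_{(0,1]} u^{Re z} + 𝟙_{(1,∞)} u^{Re z - 1}`. [folklore] -/
def bound (z : ℂ) (u : ℝ) : ℝ :=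
  (Ioc (0 : ℝ) 1).indicator (fun u ↦ u ^ z.re) u + (Ioi (1 : ℝ)).indicator (fun u ↦ u ^ (z.re - 1)) u

/-- The dominating function is integrable on `(0,∞)` when `-1 < Re z < 0`. [folklore] -/
lemma integrableOn_bound (hz0 : -1 < z.re) (hz1 : z.re < 0) : IntegrableOn (bound z) (Ioi 0) := by
  refine IntegrableOn.add ?_ ?_
  · have h : IntegrableOn (fun u : ℝ ↦ u ^ z.re) (Ioc 0 1) :=
      (intervalIntegral.intervalIntegrable_rpow' (a := 0) (b := 1) hz0).1
    exact (h.integrable_indicator measurableSet_Ioc).integrableOn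
  · have h : IntegrableOn (fun u : ℝ ↦ u ^ (z.re - 1)) (Ioi 1) :=
      integrableOn_Ioi_rpow_of_lt (by linarith) zero_lt_one
    exact (h.integrable_indicator measurableSet_Ioi).integrableOn

/-- Pointwise domination `‖e^{-εu} sin u · u^{z-1}‖ ≤ bound z u` for `u > 0`, `ε ≥ 0`. [folklore] -/
lemma norm_dampedIntegrand_le {ε u : ℝ} (hε : 0 ≤ ε) (hu : 0 < u) :
    ‖dampedIntegrand z ε u‖ ≤ bound z u := by
  unfold dampedIntegrand bound
  rw [norm_mul, Complex.norm_real, Real.norm_eq_abs, abs_mul, abs_of_pos (Real.exp_pos _),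
    norm_cpow_eq_rpow_re_of_pos hu, sub_re, one_re]
  have hexp : Real.exp (-(ε * u)) ≤ 1 := Real.exp_le_one_iff.2 (by nlinarith)
  have hsin1 : |Real.sin u| ≤ 1 := Real.abs_sin_le_one u
  have hsinu : |Real.sin u| ≤ u := by simpa [abs_of_pos hu] using (Real.abs_sin_le_abs (x := u))
  have hrpow : 0 ≤ u ^ (z.re - 1) := Real.rpow_nonneg hu.le _
  have h1 : Real.exp (-(ε * u)) * |Real.sin u| * u ^ (z.re - 1) ≤ |Real.sin u| * u ^ (z.re - 1) := by
    have : Real.exp (-(ε * u)) * |Real.sin u| ≤ |Real.sin u| :=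
      mul_le_of_le_one_left (abs_nonneg _) hexp
    exact mul_le_mul_of_nonneg_right this hrpow
  refine h1.trans ?_
  by_cases hu1 : u ≤ 1
  · have hmem : u ∈ Ioc (0 : ℝ) 1 := ⟨hu, hu1⟩
    have hnot : u ∉ Ioi (1 : ℝ) := fun h ↦ absurd hu1 (not_le.2 h)
    rw [indicator_of_mem hmem, indicator_of_notMem hnot, add_zero]
    calc |Real.sin u| * u ^ (z.re - 1) ≤ u * u ^ (z.re - 1) :=
          mul_le_mul_of_nonneg_right hsinu hrpow
      _ = u ^ z.re := by
          rw [show z.re = 1 + (z.re - 1) by ring, Real.rpow_add hu, Real.rpow_one]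
          ring_nf
  · rw [not_le] at hu1
    have hmem : u ∈ Ioi (1 : ℝ) := hu1
    have hnot : u ∉ Ioc (0 : ℝ) 1 := fun h ↦ absurd h.2 (not_le.2 hu1)
    rw [indicator_of_mem hmem, indicator_of_notMem hnot, zero_add]
    exact mul_le_of_le_one_left hrpow hsin1

/-- The damped integrand is continuous on `(0,∞)`. [folklore] -/
lemma continuousOn_dampedIntegrand (ε : ℝ) : ContinuousOn (dampedIntegrand z ε) (Ioi 0) := by
  intro u hu
  have hu : 0 < u := hu
  refine ContinuousAt.continuousWithinAt ?_
  unfold dampedIntegrand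
  refine ContinuousAt.mul (by fun_prop) ?_
  exact Complex.continuousAt_ofReal_cpow_const u (z - 1) (Or.inr hu.ne')

/-- The damped integrand is integrable on `(0,∞)` for every `ε ≥ 0` when `-1 < Re z < 0`.
[folklore] -/
lemma integrableOn_dampedIntegrand (hz0 : -1 < z.re) (hz1 : z.re < 0) {ε : ℝ} (hε : 0 ≤ ε) :
    IntegrableOn (dampedIntegrand z ε) (Ioi 0) := by
  refine Integrable.mono' (integrableOn_bound hz0 hz1)
    ((continuousOn_dampedIntegrand ε).aestronglyMeasurable measurableSet_Ioi) ?_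
  exact (ae_restrict_iff' measurableSet_Ioi).2
    (Eventually.of_forall fun u hu ↦ norm_dampedIntegrand_le hε hu)

/-- The right-hand side after integrating by parts, as a function of the damping `ε`:
`-(1/z)·Γ(z+1)·[(p+q)/2 + ε i (p-q)/2]`, `p = (1/(ε-i))^{z+1}`, `q = (1/(ε+i))^{z+1}`
(note `1/(2i) = -i/2`). [folklore] -/
def rhs (z : ℂ) (ε : ℝ) : ℂ :=
  -(1 / z) * (Gamma (z + 1) *
    (((1 / ((ε : ℂ) - I)) ^ (z + 1) + (1 / ((ε : ℂ) + I)) ^ (z + 1)) / 2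
      + (ε : ℂ) * I * ((1 / ((ε : ℂ) - I)) ^ (z + 1) - (1 / ((ε : ℂ) + I)) ^ (z + 1)) / 2))

/-- `rhs z` is continuous at `ε = 0` (the points `1/(∓i) = ±i` lie in the slit plane). [folklore] -/
lemma continuousAt_rhs (z : ℂ) : ContinuousAt (rhs z) 0 := by
  have hp : ContinuousAt (fun ε : ℝ ↦ (1 / ((ε : ℂ) - I)) ^ (z + 1)) 0 := by
    refine ContinuousAt.cpow ?_ continuousAt_const ?_
    · exact ContinuousAt.div continuousAt_const (by fun_prop) (by simp [Complex.ext_iff])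
    · rw [mem_slitPlane_iff]; right; simp
  have hq : ContinuousAt (fun ε : ℝ ↦ (1 / ((ε : ℂ) + I)) ^ (z + 1)) 0 := by
    refine ContinuousAt.cpow ?_ continuousAt_const ?_
    · exact ContinuousAt.div continuousAt_const (by fun_prop) (by simp [Complex.ext_iff])
    · rw [mem_slitPlane_iff]; right; simp
  have hε : ContinuousAt (fun ε : ℝ ↦ (ε : ℂ)) 0 := Complex.continuous_ofReal.continuousAt
  have h := (continuousAt_const (y := -(1 / z))).mul ((continuousAt_const (y := Gamma (z + 1))).mul
    (((hp.add hq).div_const 2).add ((((hε.mul (continuousAt_const (y := I))).mul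
      (hp.sub hq)).div_const 2))))
  exact h

/-- The value at `ε = 0`: `rhs z 0 = Γ(z) sin(πz/2)` (`i^{z+1} + (-i)^{z+1} = 2cos(π(z+1)/2)`,
`Γ(z+1) = zΓ(z)`). [folklore] -/
lemma rhs_zero (hz : z ≠ 0) : rhs z 0 = Gamma z * Complex.sin (π * z / 2) := by
  unfold rhs
  simp only [Complex.ofReal_zero, zero_sub, zero_add, zero_mul, zero_div, add_zero]
  have h1 : (1 : ℂ) / -I = I := by rw [div_neg, one_div, Complex.inv_I, neg_neg]
  have h2 : (1 : ℂ) / I = -I := by rw [one_div, Complex.inv_I]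
  rw [h1, h2]
  have hI : I ^ (z + 1) = Complex.exp ((π * (z + 1) / 2) * I) := by
    rw [cpow_def_of_ne_zero I_ne_zero, Complex.log_I]
    congr 1; ring
  have hnI : (-I) ^ (z + 1) = Complex.exp (-(π * (z + 1) / 2) * I) := by
    rw [cpow_def_of_ne_zero (neg_ne_zero.2 I_ne_zero), Complex.log_neg_I]
    congr 1; ring
  rw [hI, hnI, ← Complex.two_cos, show (π : ℂ) * (z + 1) / 2 = π * z / 2 + π / 2 by ring,
    Complex.cos_add_pi_div_two, Complex.Gamma_add_one _ hz]
  field_simp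

/-- Dominated convergence: `∫ e^{-εu} sin u · u^{z-1} du → ∫ sin u · u^{z-1} du` as `ε → 0+`.
[folklore] -/
lemma tendsto_integral_dampedIntegrand (hz0 : -1 < z.re) (hz1 : z.re < 0) :
    Tendsto (fun ε : ℝ ↦ ∫ u in Ioi (0 : ℝ), dampedIntegrand z ε u) (𝓝[>] 0)
      (𝓝 (∫ u in Ioi (0 : ℝ), dampedIntegrand z 0 u)) := by
  refine tendsto_integral_filter_of_dominated_convergence (bound z) ?_ ?_
    (integrableOn_bound hz0 hz1) ?_
  · exact Eventually.of_forall fun ε ↦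
      (continuousOn_dampedIntegrand ε).aestronglyMeasurable measurableSet_Ioi
  · filter_upwards [self_mem_nhdsWithin] with ε (hε : 0 < ε)
    exact (ae_restrict_iff' measurableSet_Ioi).2
      (Eventually.of_forall fun u hu ↦ norm_dampedIntegrand_le hε.le hu)
  · refine (ae_restrict_iff' measurableSet_Ioi).2 (Eventually.of_forall fun u _ ↦ ?_)
    have hc : Continuous fun ε : ℝ ↦ dampedIntegrand z ε u := by
      unfold dampedIntegrand; fun_prop
    exact (hc.tendsto 0).mono_left nhdsWithin_le_nhds

/-- For `ε > 0`, `Re z > -1`: `u ↦ e^{-εu} g(u) u^{z}` with `|g| ≤ M` is integrable on `(0,∞)`.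
[folklore] -/
lemma integrableOn_exp_mul_cpow (hz0 : -1 < z.re) {ε : ℝ} (hε : 0 < ε) {g : ℝ → ℂ}
    (hg : Continuous g) {M : ℝ} (hM : ∀ u, ‖g u‖ ≤ M) :
    IntegrableOn (fun u : ℝ ↦ ((Real.exp (-(ε * u)) : ℝ) : ℂ) * g u * (u : ℂ) ^ z) (Ioi 0) := by
  have hcont : ContinuousOn (fun u : ℝ ↦ ((Real.exp (-(ε * u)) : ℝ) : ℂ) * g u * (u : ℂ) ^ z)
      (Ioi 0) := by
    intro u hu
    have hu : 0 < u := hu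
    refine ContinuousAt.continuousWithinAt (ContinuousAt.mul (by fun_prop) ?_)
    exact Complex.continuousAt_ofReal_cpow_const u z (Or.inr hu.ne')
  have hb := (Literature.NumberTheory.LFunctions.AFE.integrableOn_exp_neg_mul_mul_rpow hε hz0).const_mul M
  refine Integrable.mono' hb (hcont.aestronglyMeasurable measurableSet_Ioi) ?_
  refine (ae_restrict_iff' measurableSet_Ioi).2 (Eventually.of_forall fun u hu ↦ ?_)
  have hu : 0 < u := hu
  rw [norm_mul, norm_mul, Complex.norm_real, Real.norm_eq_abs, abs_of_pos (Real.exp_pos _),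
    norm_cpow_eq_rpow_re_of_pos hu]
  have h0 : 0 ≤ Real.exp (-(ε * u)) * u ^ z.re := by positivity
  calc Real.exp (-(ε * u)) * ‖g u‖ * u ^ z.re = ‖g u‖ * (Real.exp (-(ε * u)) * u ^ z.re) := by ring
    _ ≤ M * (Real.exp (-(ε * u)) * u ^ z.re) := mul_le_mul_of_nonneg_right (hM u) h0

/-- **Integration by parts** for `ε > 0`:
`∫_0^∞ e^{-εu} sin u · u^{z-1} du = -(1/z) ∫_0^∞ e^{-εu}(cos u - ε sin u) u^z du`. [folklore] -/
lemma integral_dampedIntegrand_eq_parts (hz0 : -1 < z.re) (hz1 : z.re < 0) {ε : ℝ} (hε : 0 < ε) :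
    ∫ u in Ioi (0 : ℝ), dampedIntegrand z ε u =
      -(1 / z) * ∫ u in Ioi (0 : ℝ), ((Real.exp (-(ε * u)) : ℝ) : ℂ) *
        ((Real.cos u - ε * Real.sin u : ℝ) : ℂ) * (u : ℂ) ^ z := by
  have hz : z ≠ 0 := fun h ↦ by simp [h] at hz1
  -- the four functions
  set U : ℝ → ℂ := fun x ↦ ((Real.exp (-(ε * x)) * Real.sin x : ℝ) : ℂ) with hU
  set U' : ℝ → ℂ := fun x ↦ ((Real.exp (-(ε * x)) : ℝ) : ℂ) *
    ((Real.cos x - ε * Real.sin x : ℝ) : ℂ) with hU'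
  set V : ℝ → ℂ := fun x ↦ (x : ℂ) ^ z / z with hV
  set V' : ℝ → ℂ := fun x ↦ (x : ℂ) ^ (z - 1) with hV'
  have hUd : ∀ x ∈ Ioi (0 : ℝ), HasDerivAt U (U' x) x := by
    intro x _
    have h1 : HasDerivAt (fun y : ℝ ↦ Real.exp (-(ε * y))) (Real.exp (-(ε * x)) * (-ε)) x := by
      have : HasDerivAt (fun y : ℝ ↦ -(ε * y)) (-ε) x := by
        have h := ((hasDerivAt_id x).const_mul ε).neg
        simp only [id, mul_one] at h
        exact h
      exact this.exp
    have h2 := (h1.mul (Real.hasDerivAt_sin x)).ofReal_comp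
    refine h2.congr_deriv ?_
    simp only [hU']
    push_cast
    ring
  have hVd : ∀ x ∈ Ioi (0 : ℝ), HasDerivAt V (V' x) x := by
    intro x hx
    have hx : 0 < x := hx
    have h := (hasDerivAt_ofReal_cpow_const hx.ne' hz).div_const z
    refine h.congr_deriv ?_
    simp only [hV']
    field_simp
  have hUV' : IntegrableOn (U * V') (Ioi 0) := integrableOn_dampedIntegrand hz0 hz1 hε.le
  have hU'V : IntegrableOn (U' * V) (Ioi 0) := by
    have h := integrableOn_exp_mul_cpow hz0 hε (g := fun x ↦ ((Real.cos x - ε * Real.sin x : ℝ) : ℂ))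
      (by fun_prop) (M := 1 + ε) (fun u ↦ by
        rw [Complex.norm_real, Real.norm_eq_abs]
        calc |Real.cos u - ε * Real.sin u| ≤ |Real.cos u| + |ε * Real.sin u| := abs_sub _ _
          _ ≤ 1 + ε * 1 := by
              rw [abs_mul, abs_of_pos hε]
              exact add_le_add (Real.abs_cos_le_one u)
                (mul_le_mul_of_nonneg_left (Real.abs_sin_le_one u) hε.le)
          _ = 1 + ε := by ring)
    have h2 : IntegrableOn (fun x : ℝ ↦ ((Real.exp (-(ε * x)) : ℝ) : ℂ) *
        ((Real.cos x - ε * Real.sin x : ℝ) : ℂ) * (x : ℂ) ^ z / z) (Ioi 0) := h.div_const z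
    refine IntegrableOn.congr_fun h2 (fun x _ ↦ ?_) measurableSet_Ioi
    simp only [hU', hV, Pi.mul_apply]
    ring
  have h_zero : Tendsto (U * V) (𝓝[>] 0) (𝓝 0) := by
    rw [tendsto_zero_iff_norm_tendsto_zero]
    have hb : ∀ x ∈ Ioi (0 : ℝ), ‖(U * V) x‖ ≤ x ^ (z.re + 1) / ‖z‖ := by
      intro x hx
      have hx : 0 < x := hx
      simp only [Pi.mul_apply, hU, hV, norm_mul, norm_div, Complex.norm_real, Real.norm_eq_abs,
        abs_of_pos (Real.exp_pos _), norm_cpow_eq_rpow_re_of_pos hx]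
      have hsinu : |Real.sin x| ≤ x := by
        simpa [abs_of_pos hx] using (Real.abs_sin_le_abs (x := x))
      have hexp : Real.exp (-(ε * x)) ≤ 1 := Real.exp_le_one_iff.2 (by nlinarith)
      have hmain : Real.exp (-(ε * x)) * |Real.sin x| * x ^ z.re ≤ x ^ (z.re + 1) := by
        calc Real.exp (-(ε * x)) * |Real.sin x| * x ^ z.re ≤ 1 * x * x ^ z.re := by
              gcongr
          _ = x ^ (z.re + 1) := by rw [Real.rpow_add hx, Real.rpow_one]; ring
      calc Real.exp (-(ε * x)) * |Real.sin x| * (x ^ z.re / ‖z‖)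
          = (Real.exp (-(ε * x)) * |Real.sin x| * x ^ z.re) / ‖z‖ := by ring
        _ ≤ x ^ (z.re + 1) / ‖z‖ := div_le_div_of_nonneg_right hmain (norm_nonneg _)
    have hlim : Tendsto (fun x : ℝ ↦ x ^ (z.re + 1) / ‖z‖) (𝓝[>] 0) (𝓝 0) := by
      have hc : ContinuousAt (fun x : ℝ ↦ x ^ (z.re + 1) / ‖z‖) 0 :=
        (Real.continuousAt_rpow_const 0 (z.re + 1) (Or.inr (by linarith))).div_const _
      have := hc.tendsto
      rw [Real.zero_rpow (by linarith), zero_div] at this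
      exact this.mono_left nhdsWithin_le_nhds
    refine squeeze_zero' (Eventually.of_forall fun x ↦ norm_nonneg _) ?_ hlim
    exact eventually_nhdsWithin_of_forall hb
  have h_infty : Tendsto (U * V) atTop (𝓝 0) := by
    rw [tendsto_zero_iff_norm_tendsto_zero]
    have hb : ∀ᶠ x : ℝ in atTop, ‖(U * V) x‖ ≤ x ^ (-(-z.re)) / ‖z‖ := by
      filter_upwards [eventually_gt_atTop 0] with x hx
      simp only [Pi.mul_apply, hU, hV, norm_mul, norm_div, Complex.norm_real, Real.norm_eq_abs,
        abs_of_pos (Real.exp_pos _), norm_cpow_eq_rpow_re_of_pos hx, neg_neg]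
      have hexp : Real.exp (-(ε * x)) ≤ 1 := Real.exp_le_one_iff.2 (by nlinarith)
      have hmain : Real.exp (-(ε * x)) * |Real.sin x| * x ^ z.re ≤ x ^ z.re := by
        calc Real.exp (-(ε * x)) * |Real.sin x| * x ^ z.re ≤ 1 * 1 * x ^ z.re := by
              gcongr
              exact Real.abs_sin_le_one x
          _ = x ^ z.re := by ring
      calc Real.exp (-(ε * x)) * |Real.sin x| * (x ^ z.re / ‖z‖)
          = (Real.exp (-(ε * x)) * |Real.sin x| * x ^ z.re) / ‖z‖ := by ring
        _ ≤ x ^ z.re / ‖z‖ := div_le_div_of_nonneg_right hmain (norm_nonneg _)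
    have hlim : Tendsto (fun x : ℝ ↦ x ^ (-(-z.re)) / ‖z‖) atTop (𝓝 0) := by
      have := (tendsto_rpow_neg_atTop (y := -z.re) (by linarith)).div_const ‖z‖
      rwa [zero_div] at this
    exact squeeze_zero' (Eventually.of_forall fun x ↦ norm_nonneg _) hb hlim
  have hparts := integral_Ioi_mul_deriv_eq_deriv_mul hUd hVd hUV' hU'V h_zero h_infty
  have hLHS : ∫ u in Ioi (0 : ℝ), dampedIntegrand z ε u = ∫ x in Ioi (0 : ℝ), U x * V' x := rfl
  rw [hLHS, hparts, sub_zero, zero_sub]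
  have hRHS : ∫ x in Ioi (0 : ℝ), U' x * V x =
      (∫ u in Ioi (0 : ℝ), ((Real.exp (-(ε * u)) : ℝ) : ℂ) *
        ((Real.cos u - ε * Real.sin u : ℝ) : ℂ) * (u : ℂ) ^ z) / z := by
    rw [← integral_div]
    refine setIntegral_congr_fun measurableSet_Ioi fun x _ ↦ ?_
    simp only [hU', hV]
    ring
  rw [hRHS]
  field_simp

/-- The elementary damped integrals: for `ε > 0`, `Re z > -1` and real `σ`,
`∫_0^∞ e^{-εu} e^{iσu} u^z du = (1/(ε - iσ))^{z+1} Γ(z+1)` (used with `σ = ±1`). [folklore] -/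
lemma integral_exp_mul_exp_mul_cpow (hz0 : -1 < z.re) {ε : ℝ} (hε : 0 < ε) (σ : ℝ) :
    ∫ u in Ioi (0 : ℝ), ((Real.exp (-(ε * u)) : ℝ) : ℂ) * Complex.exp (σ * u * I) * (u : ℂ) ^ z =
      (1 / ((ε : ℂ) - σ * I)) ^ (z + 1) * Gamma (z + 1) := by
  have ha : 0 < (z + 1).re := by simp; linarith
  have hr : 0 < ((ε : ℂ) - σ * I).re := by simp [hε]
  rw [← Literature.NumberTheory.LFunctions.AFE.integral_cpow_mul_exp_neg_mul_Ioi_complex ha hr]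
  refine setIntegral_congr_fun measurableSet_Ioi fun u _ ↦ ?_
  rw [show z + 1 - 1 = z by ring, Complex.ofReal_exp, ← Complex.exp_add]
  rw [show -(((ε : ℂ) - σ * I) * u) = ((-(ε * u) : ℝ) : ℂ) + σ * u * I by push_cast; ring]
  ring

/-- For `ε > 0`: `∫_0^∞ e^{-εu} sin u · u^{z-1} du = rhs z ε`. [folklore] -/
lemma integral_dampedIntegrand_eq_rhs (hz0 : -1 < z.re) (hz1 : z.re < 0) {ε : ℝ} (hε : 0 < ε) :
    ∫ u in Ioi (0 : ℝ), dampedIntegrand z ε u = rhs z ε := by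
  rw [integral_dampedIntegrand_eq_parts hz0 hz1 hε, rhs]
  congr 1
  -- split the integrand into the two exponentials
  set p : ℂ := (1 / ((ε : ℂ) - I)) ^ (z + 1) with hp
  set q : ℂ := (1 / ((ε : ℂ) + I)) ^ (z + 1) with hq
  set A : ℝ → ℂ := fun u ↦ ((Real.exp (-(ε * u)) : ℝ) : ℂ) * Complex.exp (u * I) * (u : ℂ) ^ z
    with hA
  set B : ℝ → ℂ := fun u ↦ ((Real.exp (-(ε * u)) : ℝ) : ℂ) * Complex.exp (-u * I) * (u : ℂ) ^ z
    with hB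
  have hIA : ∫ u in Ioi (0 : ℝ), A u = p * Gamma (z + 1) := by
    have := integral_exp_mul_exp_mul_cpow hz0 hε 1
    simp only [Complex.ofReal_one, one_mul] at this
    simpa [hA, hp] using this
  have hIB : ∫ u in Ioi (0 : ℝ), B u = q * Gamma (z + 1) := by
    have := integral_exp_mul_exp_mul_cpow hz0 hε (-1)
    have e : (ε : ℂ) - ((-1 : ℝ) : ℂ) * I = ε + I := by push_cast; ring
    rw [e] at this
    have e2 : ∀ u : ℝ, (((-1 : ℝ) : ℂ) * u * I) = -u * I := fun u ↦ by push_cast; ring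
    simp_rw [e2] at this
    simpa [hB, hq] using this
  have hAi : IntegrableOn A (Ioi 0) := by
    have := integrableOn_exp_mul_cpow hz0 hε (g := fun u : ℝ ↦ Complex.exp (u * I))
      (by fun_prop) (M := 1) (fun u ↦ by
        rw [show (u : ℂ) * I = ((u : ℝ) : ℂ) * I by rfl, Complex.norm_exp_ofReal_mul_I])
    simpa [hA] using this
  have hBi : IntegrableOn B (Ioi 0) := by
    have := integrableOn_exp_mul_cpow hz0 hε (g := fun u : ℝ ↦ Complex.exp (-u * I))
      (by fun_prop) (M := 1) (fun u ↦ by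
        rw [show -(u : ℂ) * I = ((-u : ℝ) : ℂ) * I by push_cast; ring,
          Complex.norm_exp_ofReal_mul_I])
    simpa [hB] using this
  -- the integrand is `(A + B)/2 + ε i (A - B)/2`
  have hsplit : ∀ u : ℝ, ((Real.exp (-(ε * u)) : ℝ) : ℂ) * ((Real.cos u - ε * Real.sin u : ℝ) : ℂ) *
      (u : ℂ) ^ z = (A u + B u) / 2 + (ε : ℂ) * I * (A u - B u) / 2 := by
    intro u
    simp only [hA, hB]
    rw [Complex.ofReal_sub, Complex.ofReal_mul, Complex.ofReal_cos, Complex.ofReal_sin]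
    linear_combination (((Real.exp (-(ε * u)) : ℝ) : ℂ) * (u : ℂ) ^ z / 2) * Complex.two_cos (u : ℂ)
      - ((ε : ℂ) * ((Real.exp (-(ε * u)) : ℝ) : ℂ) * (u : ℂ) ^ z / 2) * Complex.two_sin (u : ℂ)
  simp_rw [hsplit]
  have h1 : IntegrableOn (fun u : ℝ ↦ (A u + B u) / 2) (Ioi 0) := (hAi.add hBi).div_const 2
  have h2 : IntegrableOn (fun u : ℝ ↦ (ε : ℂ) * I * (A u - B u) / 2) (Ioi 0) :=
    ((hAi.sub hBi).const_mul ((ε : ℂ) * I)).div_const 2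
  have e1 : ∫ u in Ioi (0 : ℝ), (A u + B u) / 2 = (p * Gamma (z + 1) + q * Gamma (z + 1)) / 2 := by
    rw [integral_div, integral_add hAi hBi, hIA, hIB]
  have e2 : ∫ u in Ioi (0 : ℝ), (ε : ℂ) * I * (A u - B u) / 2 =
      (ε : ℂ) * I * (p * Gamma (z + 1) - q * Gamma (z + 1)) / 2 := by
    rw [integral_div, integral_const_mul, integral_sub hAi hBi, hIA, hIB]
  rw [integral_add h1 h2, e1, e2]
  ring

end MellinSin

open MellinSin in
/-- **The Mellin transform of `sin`.** For `-1 < Re z < 0`,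
`∫_0^∞ u^{z-1} sin u du = Γ(z) sin(πz/2)` (absolutely convergent integral). [folklore] -/
theorem mellin_sin {z : ℂ} (hz0 : -1 < z.re) (hz1 : z.re < 0) :
    mellin (fun u : ℝ ↦ ((Real.sin u : ℝ) : ℂ)) z = Gamma z * Complex.sin (π * z / 2) := by
  have hz : z ≠ 0 := fun h ↦ by simp [h] at hz1
  -- the undamped integral is the limit of the damped ones, which are `rhs z ε → rhs z 0`
  have h1 := tendsto_integral_dampedIntegrand hz0 hz1
  have h2 : Tendsto (fun ε : ℝ ↦ ∫ u in Ioi (0 : ℝ), dampedIntegrand z ε u) (𝓝[>] 0)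
      (𝓝 (rhs z 0)) := by
    have hc := ((continuousAt_rhs z).tendsto).mono_left (nhdsWithin_le_nhds (s := Ioi (0 : ℝ)))
    refine hc.congr' ?_
    filter_upwards [self_mem_nhdsWithin] with ε (hε : 0 < ε)
    exact (integral_dampedIntegrand_eq_rhs hz0 hz1 hε).symm
  have heq := tendsto_nhds_unique h1 h2
  rw [rhs_zero hz] at heq
  rw [← heq, mellin]
  refine setIntegral_congr_fun measurableSet_Ioi fun u _ ↦ ?_
  simp [dampedIntegrand, smul_eq_mul, mul_comm]

open MellinSin in
/-- The Mellin transform of `sin` converges absolutely on `-1 < Re z < 0`. [folklore] -/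
theorem mellinConvergent_sin {z : ℂ} (hz0 : -1 < z.re) (hz1 : z.re < 0) :
    MellinConvergent (fun u : ℝ ↦ ((Real.sin u : ℝ) : ℂ)) z := by
  have h := integrableOn_dampedIntegrand hz0 hz1 (le_refl (0 : ℝ))
  refine (h.congr_fun (fun u _ ↦ ?_) measurableSet_Ioi)
  simp [dampedIntegrand, smul_eq_mul, mul_comm]

/-- `HasMellin` form of `Literature.Analysis.SpecialFunctions.mellin_sin`. [folklore] -/
theorem hasMellin_sin {z : ℂ} (hz0 : -1 < z.re) (hz1 : z.re < 0) :
    HasMellin (fun u : ℝ ↦ ((Real.sin u : ℝ) : ℂ)) z (Gamma z * Complex.sin (π * z / 2)) :=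
  ⟨mellinConvergent_sin hz0 hz1, mellin_sin hz0 hz1⟩

/-! ## The kernel `sin(2πt)/(πt)` -/

/-- The kernel `t ↦ sin(2πt)/(πt) = 2·sinc(2πt)` (Báez-Duarte's `Uχ`), complex-valued, defined
through Mathlib's `Real.sinc` (`sinc x = sin x/x`, `sinc 0 = 1`), so that `sincKernel 0 = 2` is the
limiting value and `sincKernel` is continuous on `ℝ`. [folklore] -/
def sincKernel (t : ℝ) : ℂ :=
  ((2 * Real.sinc (2 * π * t) : ℝ) : ℂ)

/-- For `t ≠ 0`: `sincKernel t = sin(2πt)/(πt)`. [folklore] -/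
lemma sincKernel_eq {t : ℝ} (ht : t ≠ 0) : sincKernel t = ((Real.sin (2 * π * t) / (π * t) : ℝ) : ℂ) := by
  unfold sincKernel
  have h2πt : 2 * π * t ≠ 0 := by positivity
  rw [Real.sinc_of_ne_zero h2πt]
  congr 1
  field_simp

/-- `sincKernel 0 = 2` (the limit of `sin(2πt)/(πt)` at `0`). [folklore] -/
lemma sincKernel_zero : sincKernel 0 = 2 := by
  simp [sincKernel]

/-- `sincKernel` is continuous. [folklore] -/
lemma continuous_sincKernel : Continuous sincKernel := by
  unfold sincKernel
  exact Complex.continuous_ofReal.comp (continuous_const.mul (Real.continuous_sinc.comp (by fun_prop)))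

/-- `sincKernel` is continuous on `(0, ∞)`. [folklore] -/
lemma continuousOn_sincKernel : ContinuousOn sincKernel (Ioi 0) :=
  continuous_sincKernel.continuousOn

/-- `sincKernel` is measurable. [folklore] -/
lemma measurable_sincKernel : Measurable sincKernel :=
  continuous_sincKernel.measurable

/-- `|sin(2πt)/(πt)| ≤ 2` (`|sinc| ≤ 1`). [folklore] -/
lemma norm_sincKernel_le_two (t : ℝ) : ‖sincKernel t‖ ≤ 2 := by
  unfold sincKernel
  rw [Complex.norm_real, Real.norm_eq_abs, abs_mul, abs_two]
  have := Real.abs_sinc_le_one (2 * π * t)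
  linarith

/-- `|sin(2πt)/(πt)| ≤ 1/(π|t|)` for `t ≠ 0`. [folklore] -/
lemma norm_sincKernel_le_inv {t : ℝ} (ht : t ≠ 0) : ‖sincKernel t‖ ≤ 1 / (π * |t|) := by
  rw [sincKernel_eq ht, Complex.norm_real, Real.norm_eq_abs, abs_div, abs_mul, abs_of_pos Real.pi_pos]
  exact div_le_div_of_nonneg_right (Real.abs_sin_le_one _) (by positivity)

/-- **The Mellin transform of `sin(2πt)/(πt)`**: for `0 < Re s < 1`,
`∫_0^∞ (sin 2πt/(πt)) t^{s-1} dt = -2(2π)^{-s} cos(πs/2) Γ(s-1)`; by `riemannZeta_one_sub` this is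
`ζ(1-s)/((1-s)ζ(s))` wherever `ζ(s) ≠ 0` (Báez-Duarte: `Uχ = sin(2πt)/(πt)`; Burnol 2002, proof of
Thm. 5.3). [folklore] -/
theorem hasMellin_sincKernel {s : ℂ} (hs0 : 0 < s.re) (hs1 : s.re < 1) :
    HasMellin sincKernel s (-(2 * (2 * π : ℂ) ^ (-s) * Complex.cos (π * s / 2) * Gamma (s - 1))) := by
  have hz0 : -1 < (s - 1).re := by simp; linarith
  have hz1 : (s - 1).re < 0 := by simp; linarith
  have h2π : (0 : ℝ) < 2 * π := by positivity
  -- `g(t) = sin(2πt)/π`, so that `sincKernel t = t^{-1} • g t` on `t > 0`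
  set g : ℝ → ℂ := fun t ↦ ((Real.sin ((2 * π) * t) : ℝ) : ℂ) / π with hg
  have hgconv : MellinConvergent g (s - 1) := by
    refine MellinConvergent.div_const ?_ _
    exact (MellinConvergent.comp_mul_left h2π).2 (mellinConvergent_sin hz0 hz1)
  have hgval : mellin g (s - 1) =
      ((2 * π : ℝ) : ℂ) ^ (-(s - 1)) * (Gamma (s - 1) * Complex.sin (π * (s - 1) / 2)) / π := by
    rw [hg, mellin_div_const, mellin_comp_mul_left (fun y : ℝ ↦ ((Real.sin y : ℝ) : ℂ)) (s - 1) h2π,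
      mellin_sin hz0 hz1, smul_eq_mul]
  have hfun : ∀ t ∈ Ioi (0 : ℝ), (t : ℂ) ^ (s - 1) • sincKernel t =
      (t : ℂ) ^ (s - 1) • ((t : ℂ) ^ (-1 : ℂ) • g t) := by
    intro t ht
    have ht : 0 < t := ht
    have ht' : (t : ℂ) ≠ 0 := by exact_mod_cast ht.ne'
    rw [sincKernel_eq ht.ne']
    simp only [hg, smul_eq_mul, cpow_neg_one]
    push_cast
    field_simp
  have hconv : MellinConvergent sincKernel s := by
    have h := (MellinConvergent.cpow_smul (f := g) (s := s) (a := -1)).2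
      (by rw [show s + -1 = s - 1 by ring]; exact hgconv)
    exact (h.congr_fun (fun t ht ↦ (hfun t ht).symm) measurableSet_Ioi)
  refine ⟨hconv, ?_⟩
  rw [mellin, setIntegral_congr_fun measurableSet_Ioi hfun, ← mellin, mellin_cpow_smul,
    show s + -1 = s - 1 by ring, hgval]
  have hπ : (π : ℂ) ≠ 0 := by exact_mod_cast Real.pi_ne_zero
  have h2πc : ((2 * π : ℝ) : ℂ) ≠ 0 := by exact_mod_cast h2π.ne'
  rw [show (π : ℂ) * (s - 1) / 2 = π * s / 2 - π / 2 by ring, Complex.sin_sub_pi_div_two,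
    show -(s - 1) = -s + 1 by ring, cpow_add _ _ h2πc, cpow_one]
  push_cast
  field_simp

/-- The Mellin transform of `sincKernel` converges absolutely on `0 < Re s < 1`. [folklore] -/
theorem mellinConvergent_sincKernel {s : ℂ} (hs0 : 0 < s.re) (hs1 : s.re < 1) :
    MellinConvergent sincKernel s :=
  (hasMellin_sincKernel hs0 hs1).1

end Literature.Analysis.SpecialFunctions
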